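import Summits.ResolutionOfSingularities.ResolutionOfSingularities.Theorems.RadicialJungCleanModelsSufficeGamePointData
import Literature.AlgebraicGeometry.Resolution.AlterationsStrong

/-!
# Route `RadicialJung`, crux `CleanModelsSuffice` (stmt-ResolutionOfSingularities-15883), line `Sketch`:
# stub `stub_gameInit` — the initial state of the exceptionalisation game

Skeleton v4 of the crux
`Summit.ResolutionOfSingularities.ResolutionOfSingularities.Theses.RadicialJung.CleanModelsSuffice`.
A pointwise log-clean pair `(V, L)` (`V` regular, integral, of finite type over a field `k` of
characteristic `p`; `L / K(V)` purely inseparable of degree `p`; at every `v ∈ V` a clean presentation,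
toroidal or of regular type) carries a `GameState p V L V (𝟙 V)` (`…GameDefs`) with NO exceptional
divisor (`E = []`) and bounded embedding dimensions.

Proof. Point by point (`GameState.PointData`, `GameState.ofPointData` of `…GamePointData`):
* toroidal presentation `g = ∏_{i<m} t_i^{a_i}` in a regular system `t : Fin d → 𝒪_{V,v}`: take
  `u := t`, the exponents `a` extended by `0` to `Fin d`, unit `1`; the REG clause is vacuous (`a_0` is
  prime to `p`, so not `0`);
* presentation of regular type `g = u₀` (a unit): take ANY regular system of parameters of the regular
  `𝒪_{V,v}` (`exists_regularSystemOfParameters`), all exponents `0`, unit `u₀`; with `E = []` the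
  boundary span in the REG clause is `⊥`, so the clause is the hypothesis (W)/(T) verbatim;
* the labelling of the (absent) exceptional divisors is the empty function;
* `(𝟙 V)^* g = g` (`RatFn.functionFieldMap_id`).
Bound: `d v = emb dim 𝒪_{V,v} = dim 𝒪_{V,v} ≤ dim V` (`Scheme.topologicalKrullDim_eq_iSup_ringKrullDim_stalk`)
and `dim V < ∞` for `V` quasi-compact and locally of finite type over `k`
(`exists_topologicalKrullDim_le_of_locallyOfFiniteType`).
-/

noncomputable section

set_option linter.dupNamespace false -- mandated namespace of this single-conjunct summit

open CategoryTheory AlgebraicGeometry TopologicalSpace IsLocalRing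
open Literature.AlgebraicGeometry.Resolution Literature.AlgebraicGeometry.Motives

namespace Summit.ResolutionOfSingularities.ResolutionOfSingularities.Theorems.RadicialJung.CleanModelsSuffice

/-! ## Reindexing a monomial from `Fin m` to `Fin d ⊇ Fin m` -/

/-- Extending exponents `a : Fin m → ℕ` by `0` along `Fin.castLE : Fin m → Fin d` does not change the
monomial `∏ xᵢ^{aᵢ}`. [folklore] -/
theorem prod_pow_extend_castLE {M : Type*} [CommMonoid M] {d m : ℕ} (hmd : m ≤ d) (x : Fin d → M)
    (a : Fin m → ℕ) :
    ∏ j : Fin d, x j ^ (if h : (j : ℕ) < m then a ⟨j, h⟩ else 0) =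
      ∏ i : Fin m, x (Fin.castLE hmd i) ^ a i := by
  classical
  set aext : Fin d → ℕ := fun j => if h : (j : ℕ) < m then a ⟨j, h⟩ else 0 with haext
  have h1 : ∀ i : Fin m, aext (Fin.castLE hmd i) = a i := fun i => by
    simp [haext, i.is_lt]
  symm
  calc ∏ i : Fin m, x (Fin.castLE hmd i) ^ a i
      = ∏ i : Fin m, (fun j => x j ^ aext j) (Fin.castLEEmb hmd i) :=
        Finset.prod_congr rfl fun i _ => by simp only [Fin.coe_castLEEmb, h1]
    _ = ∏ j ∈ (Finset.univ : Finset (Fin m)).map (Fin.castLEEmb hmd), x j ^ aext j :=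
        (Finset.prod_map Finset.univ (Fin.castLEEmb hmd) fun j => x j ^ aext j).symm
    _ = ∏ j, x j ^ aext j :=
        Finset.prod_subset (Finset.subset_univ _) fun j _ hj => by
          have hjm : ¬ (j : ℕ) < m := fun h =>
            hj (Finset.mem_map.mpr ⟨⟨j, h⟩, Finset.mem_univ _, Fin.ext rfl⟩)
          simp [haext, hjm]

/-! ## The pointwise data of the initial state -/

section Pointwise

variable (p : ℕ) {V : Scheme.{0}} [IsIntegral V] {L : Type} [Field L] [Algebra V.functionField L]
  (v : V) (hreg : IsRegularLocalRing (V.presheaf.stalk v)) {y : L} {g : V.functionField}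
  (hy : y ∉ Set.range (algebraMap V.functionField L)) (hyg : algebraMap V.functionField L g = y ^ p)

omit [IsIntegral V] in
/-- With no exceptional divisor, no divisor is to be labelled. [folklore] -/
theorem isEmpty_labels_nil (x : V) :
    IsEmpty {D : V.IdealSheafData // D ∈ ([] : List V.IdealSheafData) ∧ x ∈ D.support} :=
  ⟨fun D => absurd D.2.1 (by simp)⟩

include hreg hy hyg in
/-- **Initial pointwise data, toroidal case.** A toroidal clean presentation
`g = ∏_{i<m} t_i^{a_i}` (`t` a regular system of parameters of `𝒪_{V,v}`, `0 < m`, all `a_i` prime to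
`p`) is the pointwise data of a game state on the identity model with `E = []`: coordinates `t`,
exponents `a` extended by `0`, unit `1`. [folklore] -/
theorem nonempty_pointData_nil_of_toroidal {d m : ℕ} (hmd : m ≤ d) (t : Fin d → V.presheaf.stalk v)
    (a : Fin m → ℕ) (ht : Ideal.span (Set.range t) = maximalIdeal (V.presheaf.stalk v))
    (hdim : ringKrullDim (V.presheaf.stalk v) = (d : WithBot ℕ∞)) (hm : 0 < m)
    (ha : ∀ i, ¬ p ∣ a i)
    (hg : g = ∏ i : Fin m,
      (algebraMap (V.presheaf.stalk v) V.functionField (t (Fin.castLE hmd i))) ^ (a i)) :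
    Nonempty (GameState.PointData p V L V (𝟙 V) [] v) := by
  classical
  haveI := isEmpty_labels_nil (V := V) v
  refine ⟨{
    d := d
    u := t
    a := fun j => if h : (j : ℕ) < m then a ⟨j, h⟩ else 0
    w := 1
    lab := fun D => isEmptyElim D
    y := y
    g := g
    isRegular := hreg
    spanFinrank_eq := ?_
    span_u := ht
    a_spec := ?_
    isUnit_w := isUnit_one
    lab_injective := fun D => isEmptyElim D
    stalkIdeal_lab := fun D => isEmptyElim D
    y_not_mem := hy
    y_pow := hyg
    map_g := ?_
    reg := ?_ }⟩
  · -- `emb dim = dim = d`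
    have h := hreg.spanFinrank_maximalIdeal
    rw [hdim] at h
    exact_mod_cast h
  · intro j
    by_cases h : (j : ℕ) < m
    · exact Or.inr (by rw [dif_pos h]; exact ha _)
    · exact Or.inl (by rw [dif_neg h])
  · rw [RatFn.functionFieldMap_id, RingHom.id_apply, hg, one_mul,
      map_prod (algebraMap (V.presheaf.stalk v) V.functionField)]
    simp_rw [map_pow]
    exact (prod_pow_extend_castLE hmd
      (fun j => algebraMap (V.presheaf.stalk v) V.functionField (t j)) a).symm
  · -- the REG clause is vacuous: `a_0 ≠ 0`
    intro h0
    exfalso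
    have h := h0 ⟨0, lt_of_lt_of_le hm hmd⟩
    simp only [hm, dif_pos] at h
    exact ha ⟨0, hm⟩ (by rw [h]; exact dvd_zero p)

include hreg hy hyg in
/-- **Initial pointwise data, regular type.** A clean presentation of regular type `g = u₀` (a unit of
`𝒪_{V,v}`, wound or transversal) is the pointwise data of a game state on the identity model with
`E = []`: any regular system of parameters, all exponents `0`, unit `u₀`; the boundary span of the REG
clause is `⊥`. [folklore] -/
theorem nonempty_pointData_nil_of_regularType (u₀ : V.presheaf.stalk v) (hu₀ : IsUnit u₀)
    (hg : g = algebraMap (V.presheaf.stalk v) V.functionField u₀)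
    (hWT : (∀ c : V.presheaf.stalk v, u₀ - c ^ p ∉ maximalIdeal (V.presheaf.stalk v)) ∨
      (∃ c : V.presheaf.stalk v, u₀ - c ^ p ∈ maximalIdeal (V.presheaf.stalk v) ∧
        u₀ - c ^ p ∉ maximalIdeal (V.presheaf.stalk v) ^ 2)) :
    Nonempty (GameState.PointData p V L V (𝟙 V) [] v) := by
  classical
  haveI := isEmpty_labels_nil (V := V) v
  haveI := hreg
  obtain ⟨t, ht⟩ := exists_regularSystemOfParameters (R := V.presheaf.stalk v)
  refine ⟨{
    d := (maximalIdeal (V.presheaf.stalk v)).spanFinrank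
    u := t
    a := fun _ => 0
    w := u₀
    lab := fun D => isEmptyElim D
    y := y
    g := g
    isRegular := hreg
    spanFinrank_eq := rfl
    span_u := ht
    a_spec := fun _ => Or.inl rfl
    isUnit_w := hu₀
    lab_injective := fun D => isEmptyElim D
    stalkIdeal_lab := fun D => isEmptyElim D
    y_not_mem := hy
    y_pow := hyg
    map_g := ?_
    reg := fun _ => ?_ }⟩
  · rw [RatFn.functionFieldMap_id, RingHom.id_apply, hg]
    simp
  · have hbot : Ideal.span (t '' Set.range (fun D : {D : V.IdealSheafData //
        D ∈ ([] : List V.IdealSheafData) ∧ v ∈ D.support} => (isEmptyElim D : Fin _))) = ⊥ := by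
      rw [Set.range_eq_empty, Set.image_empty, Ideal.span_empty]
    rw [hbot, sup_bot_eq]
    exact hWT

end Pointwise

/-! ## The bound on the embedding dimensions -/

/-- `dim 𝒪_{V,v} ≤ n` uniformly in `v`, for `V` quasi-compact and locally of finite type over a field:
`dim 𝒪_{V,v} ≤ dim V < ∞`. [folklore] -/
theorem exists_ringKrullDim_stalk_le_nat {k : Type} [Field k] {V : Scheme.{0}}
    (f : V ⟶ Spec (.of k)) [LocallyOfFiniteType f] [QuasiCompact f] :
    ∃ n : ℕ, ∀ v : V, ringKrullDim (V.presheaf.stalk v) ≤ n := by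
  haveI : CompactSpace V := QuasiCompact.compactSpace_of_compactSpace f
  obtain ⟨n, hn⟩ := exists_topologicalKrullDim_le_of_locallyOfFiniteType f
  refine ⟨n, fun v => le_trans ?_ hn⟩
  rw [Literature.AlgebraicGeometry.Motives.Scheme.topologicalKrullDim_eq_iSup_ringKrullDim_stalk]
  exact le_iSup (fun x : V => ringKrullDim (V.presheaf.stalk x)) v

/-! ## The stub -/

/-- STUB (game, initial state). A pointwise log-clean pair `(V, L)` carries a `GameState` on the
identity model with no exceptional divisor (and the embedding dimensions are bounded, by `dim V`): the
clean presentations of the hypothesis, verbatim (toroidal: the charged parameters with their exponents,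
unit `1`; regular type: all exponents `0`, unit `u₀`); `d v = dim 𝒪_{V,v} ≤ dim V`. [folklore] -/
theorem stub_gameInit (p : ℕ) (hp : p.Prime) (k : Type) [Field k] [CharP k p]
    (V : Scheme.{0}) [IsIntegral V] (f : V ⟶ Spec (.of k)) (L : Type) [Field L]
    [Algebra V.functionField L] [IsSeparated f] [LocallyOfFiniteType f] [QuasiCompact f]
    (hVreg : Scheme.IsRegular V) [IsPurelyInseparable V.functionField L]
    (hdeg : Module.finrank V.functionField L = p)
    (hclean : ∀ v : V, ∃ (y : L) (g : V.functionField),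
      y ∉ Set.range (algebraMap V.functionField L) ∧ algebraMap V.functionField L g = y ^ p ∧
      ((∃ (d m : ℕ) (hmd : m ≤ d) (t : Fin d → V.presheaf.stalk v) (a : Fin m → ℕ),
          Ideal.span (Set.range t) = IsLocalRing.maximalIdeal (V.presheaf.stalk v) ∧
          ringKrullDim (V.presheaf.stalk v) = (d : WithBot ℕ∞) ∧ 0 < m ∧ (∀ i, ¬ p ∣ a i) ∧
          g = ∏ i : Fin m,
            (algebraMap (V.presheaf.stalk v) V.functionField (t (Fin.castLE hmd i))) ^ (a i)) ∨
        (∃ u₀ : V.presheaf.stalk v, IsUnit u₀ ∧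
          g = algebraMap (V.presheaf.stalk v) V.functionField u₀ ∧
          ((∀ c : V.presheaf.stalk v,
              u₀ - c ^ p ∉ IsLocalRing.maximalIdeal (V.presheaf.stalk v)) ∨
            (∃ c : V.presheaf.stalk v,
              u₀ - c ^ p ∈ IsLocalRing.maximalIdeal (V.presheaf.stalk v) ∧
              u₀ - c ^ p ∉ IsLocalRing.maximalIdeal (V.presheaf.stalk v) ^ 2))))) :
    ∃ S : GameState p V L V (𝟙 V), S.E = [] ∧ ∃ n : ℕ, ∀ v, S.d v ≤ n := by
  classical
  -- (`hp`, `hdeg` are part of the registered signature; the construction does not need them)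
  have _hp := hp
  have _hdeg := hdeg
  -- pointwise data
  have hP : ∀ v : V, Nonempty (GameState.PointData p V L V (𝟙 V) [] v) := by
    intro v
    obtain ⟨y, g, hy, hyg, h⟩ := hclean v
    rcases h with ⟨d, m, hmd, t, a, ht, hdim, hm, ha, hg⟩ | ⟨u₀, hu₀, hg, hWT⟩
    · exact nonempty_pointData_nil_of_toroidal p v (hVreg v) hy hyg hmd t a ht hdim hm ha hg
    · exact nonempty_pointData_nil_of_regularType p v (hVreg v) hy hyg u₀ hu₀ hg hWT
  -- the bound `dim 𝒪_{V,v} ≤ n`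
  obtain ⟨n, hn⟩ := exists_ringKrullDim_stalk_le_nat f
  refine ⟨GameState.ofPointData [] fun v => (hP v).some, rfl, n, fun v => ?_⟩
  show ((hP v).some).d ≤ n
  have h1 := ((hP v).some).spanFinrank_eq
  have h2 := ((hP v).some).isRegular.spanFinrank_maximalIdeal
  have h3 : ((((hP v).some).d : ℕ) : WithBot ℕ∞) ≤ n := by
    rw [← h1, h2]
    exact hn v
  exact_mod_cast h3

end Summit.ResolutionOfSingularities.ResolutionOfSingularities.Theorems.RadicialJung.CleanModelsSuffice

end
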